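import Literature.NumberTheory.GaloisCohomology.Howard2004.FiniteSingularNatural
import Literature.NumberTheory.GaloisRepresentations.TameInertiaGeneratorEvaluationProofs
import Literature.NumberTheory.GaloisRepresentations.InertiaHomFrobeniusTwist
import Literature.NumberTheory.GaloisRepresentations.HOneRestrictionOntoInvariantsFinite
import Literature.NumberTheory.GaloisRepresentations.LocalHOneInertiaRestrictionProfinite
import Literature.NumberTheory.GaloisRepresentations.UnramifiedClassesInertia
import Literature.NumberTheory.GaloisRepresentations.ContinuousH1TrivialAction
import Literature.NumberTheory.GaloisRepresentations.ContinuousH1RestrictScalars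
import Literature.NumberTheory.GaloisRepresentations.LocalGaloisGroupFrobeniusProofs
import HarnessLib

/-!
# Howard 2004, Prop. 1.1.7: `H¹_f(K_v, T) ≅ T` and `H¹_s(K_v, T) ⊗ k_vˣ ≅ T` by EVALUATION
# (local module with trivial action; the two isomorphisms behind the finite–singular map, PROVED)

Topic `NumberTheory/GaloisCohomology/Howard2004` (sequel to `FiniteSingularNatural`; cell
`pub/bsd-print-x9`, lit g32, obligation (n1) of x9-p1 LEAD g3's ruling 2026-08-28T15:36:26Z).
DEFINITIONS WITH BODIES + THEOREMS ONLY (no named fact, no instance, no `sorry`).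

Howard, Def. 1.1.8 [arXiv:1202.6340 p. 5, L144–149]: «If `v` does not divide `p`, `G_{K_v}` acts
trivially on `T`, and `|k_vˣ|·T = 0`, we define the finite-singular comparison map to be the
isomorphism `φ^{fs}_v : H¹_f(K_v,T) ≅ T ≅ H¹_s(K_v,T) ⊗ k_vˣ` given by Proposition 1.1.7», and
Prop. 1.1.7 [p. 5, L129–141] (= Mazur–Rubin, *Kolyvagin systems*, Lemma 1.2.1): «There are
canonical isomorphisms `H¹_f(K_v,T) ≅ T/(Frob_v − 1)T`, `H¹_s(K_v,T) ⊗ k_vˣ ≅ T^{Frob_v=1}`.  The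
first map is given on cocycles by evaluation at the Frobenius automorphism, and the second by
`c ⊗ α ↦ c(σ_α)` where `σ_α ∈ Gal(K_v^ab/K_v^unr)` is the Artin symbol of any lift of `α`».

This file proves the two isomorphisms IN THE KERNEL for a discrete module `N` over a
non-archimedean local field `F` on which `Γ_F` acts TRIVIALLY (Howard's standing at a Kolyvagin
prime `λ ∈ n`: `T/I_nT` is unramified at `λ` and `Frob_λ ≡ 1 mod I_ℓ ⊆ I_n`), in the EVALUATION
form in which a slot for `φ^{fs}` can be filled (`Howard2004/FiniteSingularTame.lean`):

* `evalCocycle`, **`evalClass ρ htriv γ : H¹(F, N) →+ N`**, `[z] ↦ z(γ)` (trivial action: a class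
  IS a continuous homomorphism, tree `oneCocycleClass_injective_of_trivial`);
* **`singularEval ρ htriv σ₀ : H¹_s(F, N) →+ N`**, `c̄ ↦ z(σ₀)` for `σ₀ ∈ I_F` (unramified classes
  vanish on inertia, tree `oneCocycleClass_mem_unramifiedSubgroup_iff_forall_eq_zero`);
* **`IsTameGenerator σ₀`**: the tame character of level `q − 1` takes a PRIMITIVE `(q−1)`-th root
  of unity at `σ₀ ∈ I_F` (`q = #k_F`; tree `kummerCharacterQuot`) — the inertia elements «`σ_α`,
  `α` a generator of `k_vˣ`» of Prop. 1.1.7 read through the tame character `I_F ↠ k_Fˣ`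
  (Serre 1972 §1.3) instead of the Artin symbol on units (the two readings differ by `α ↦ α^{±1}`,
  Serre, *Local Fields* XIV §3; see `FiniteSingularNatural`, reading note (v));
  `exists_isTameGenerator`; `IsTameGenerator.apply_eq_zero` / `.exists_apply_eq` (evaluation at
  `σ₀` is injective / surjective on continuous homomorphisms `I_F → A` of exponent `q − 1`; tree
  `apply_eq_zero_of_apply_eq_zero_of_isPrimitiveRoot`, `exists_continuous_apply_eq_of_isPrimitiveRoot`);
* **`singularEval_injective`**, **`singularEval_surjective`** — «`H¹_s(K_v,T) ⊗ k_vˣ ≅ T`» in the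
  form `H¹_s(F, N) ≅ N`, `c̄ ↦ z(σ₀)`, for `(q − 1)·N = 0` (= Howard's «`|k_vˣ|·T = 0`») and `N`
  finite; surjectivity = a tame homomorphism with prescribed value at `σ₀` (level `q − 1`), its
  Frobenius-invariance (`f(φσφ⁻¹) = q·f(σ)`, tree `apply_frob_conj_eq_card_nsmul`) and the
  extension `H¹(F, N) ↠ H¹(I_F, N)^{Fr}` (tree `exists_resSubgroup_absInertia_eq_of_conjMap_eq`);
* **`evalClass_eq_zero_of_mem_unramified`** / **`exists_mem_unramified_evalClass_eq`** —
  «`H¹_f(K_v,T) ≅ T/(Frob_v − 1)T = T`»: evaluation at an arithmetic Frobenius lift `φ` is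
  injective on `H¹_ur(F, N)` and onto `N` (tree `oneCocycleClass_eq_zero_iff_of_vanishing_absInertia`,
  `exists_vanishing_apply_eq_of_isFreeProcyclic` + (KM4) `exists_contOneCocycles_apply_eq_of_finite`);
  `evalClass_eq_of_mem_unramified` (independence of the Frobenius lift on `H¹_ur`).

BSD is not proved by any of this.

References: B. Howard, *The Heegner point Kolyvagin system*, Compositio Math. 140 (2004),
Prop. 1.1.7 / Def. 1.1.8 (arXiv:1202.6340 Prop. 2.1.7 / Def. 2.1.8, p. 5); B. Mazur, K. Rubin,
*Kolyvagin systems*, Mem. AMS 799 (2004), Lemma 1.2.1; K. Rubin, *Euler systems* (2000),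
Lemma 1.3.2 and Lemma 1.4.7; J.-P. Serre, *Propriétés galoisiennes…*, Invent. Math. 15 (1972),
§1.3 Prop. 2, §1.7 Prop. 5, §1.8 Prop. 6.
-/

set_option autoImplicit false

noncomputable section

open Function Field ValuativeRel
open scoped Classical

namespace Literature.NumberTheory.GaloisCohomology.Howard2004

open Literature.NumberTheory.GaloisRepresentations
open Literature.NumberTheory.GaloisRepresentations.DiscreteGaloisModule
open Literature.NumberTheory.GaloisRepresentations.IsNonarchimedeanLocalField
open Literature.NumberTheory.EllipticCurves (subgroupConj subgroupConj_apply_coe conj_mem_of_normal)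
open Literature.GroupTheory (dense_zpowers_mk_topologicalClosure' exists_isOpen_index_topologicalClosure_zpowers)

section Local

variable {F : Type} [Field F] [ValuativeRel F] [TopologicalSpace F] [IsNonarchimedeanLocalField F]
  {N : Type} [AddCommGroup N] [TopologicalSpace N] [DiscreteTopology N]

/-! ## §1 Evaluation of classes of a module with trivial action -/

/-- Evaluation of continuous crossed homomorphisms at `γ ∈ Γ_F`, as an additive map.
[cite: Howard2004HeegnerKolyvagin, Prop. 1.1.7 (arXiv p. 5, L137–138: «given on cocycles by evaluation»)] -/
def evalCocycle (ρ : DiscreteGaloisModule F N) (γ : absoluteGaloisGroup F) :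
    contOneCocycles ρ.toTopRep →+ N where
  toFun z := z.1 γ
  map_zero' := rfl
  map_add' _ _ := rfl

omit [ValuativeRel F] [TopologicalSpace F] [IsNonarchimedeanLocalField F] in
/-- Unfolding `evalCocycle`. [cite: Howard2004HeegnerKolyvagin, Prop. 1.1.7 (arXiv p. 5)] -/
@[simp] theorem evalCocycle_apply (ρ : DiscreteGaloisModule F N) (γ : absoluteGaloisGroup F)
    (z : contOneCocycles ρ.toTopRep) : evalCocycle ρ γ z = z.1 γ := rfl

/-- **Evaluation at `γ` on `H¹(F, N)`** for a module with TRIVIAL `Γ_F`-action: `[z] ↦ z(γ)` (every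
coboundary vanishes, so the value does not depend on the representative; a class IS a continuous
homomorphism `Γ_F → N`).  With `γ` an arithmetic Frobenius this is the first isomorphism of
Prop. 1.1.7 on `H¹_f = H¹_ur` («evaluation at the Frobenius automorphism»).
[cite: Howard2004HeegnerKolyvagin, Prop. 1.1.7 (arXiv Prop. 2.1.7, p. 5, L129–138)]
[cite: SerreGaloisCohomology1997, I §2.3 (`H¹(G, A) = Hom(G, A)` for trivial `A`)] -/
def evalClass (ρ : DiscreteGaloisModule F N) (htriv : ∀ (σ : absoluteGaloisGroup F) (x : N), ρ σ x = x)
    (γ : absoluteGaloisGroup F) : galoisCohomology ρ 1 →+ N :=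
  liftH1Add ρ.toTopRep (evalCocycle ρ γ) fun z hz => by
    obtain ⟨v, hv⟩ := (oneCocycleClass_eq_zero_iff ρ.toTopRep z).mp hz
    rw [evalCocycle_apply, hv γ, ContinuousRep.toTopRep_ρ_apply, htriv, sub_self]

omit [ValuativeRel F] [TopologicalSpace F] [IsNonarchimedeanLocalField F] in
/-- `evalClass [z] = z(γ)`. [cite: Howard2004HeegnerKolyvagin, Prop. 1.1.7 (arXiv p. 5, L137–138)] -/
@[simp] theorem evalClass_oneCocycleClass (ρ : DiscreteGaloisModule F N)
    (htriv : ∀ (σ : absoluteGaloisGroup F) (x : N), ρ σ x = x) (γ : absoluteGaloisGroup F)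
    (z : contOneCocycles ρ.toTopRep) :
    evalClass ρ htriv γ (oneCocycleClass ρ.toTopRep z) = z.1 γ :=
  liftH1Add_oneCocycleClass ρ.toTopRep (evalCocycle ρ γ) _ z

/-- For a trivial action, a class is unramified iff some (every) representative vanishes on `I_F`.
[cite: MilneADT2006, Ch. I §2 (unramified cohomology)] -/
theorem mem_unramified_iff_forall_apply_eq_zero (ρ : DiscreteGaloisModule F N)
    (htriv : ∀ (σ : absoluteGaloisGroup F) (x : N), ρ σ x = x) (z : contOneCocycles ρ.toTopRep) :
    oneCocycleClass ρ.toTopRep z ∈ unramifiedSubgroup ρ 1 ↔ ∀ τ ∈ absInertia F, z.1 τ = 0 :=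
  oneCocycleClass_mem_unramifiedSubgroup_iff_forall_eq_zero ρ (fun τ _ w => htriv τ w) z

/-- Unramified classes vanish at inertia elements. [cite: MilneADT2006, Ch. I §2] -/
theorem evalClass_eq_zero_of_mem_unramified_of_mem_absInertia (ρ : DiscreteGaloisModule F N)
    (htriv : ∀ (σ : absoluteGaloisGroup F) (x : N), ρ σ x = x) {σ : absoluteGaloisGroup F}
    (hσ : σ ∈ absInertia F) {c : galoisCohomology ρ 1} (hc : c ∈ unramifiedSubgroup ρ 1) :
    evalClass ρ htriv σ c = 0 := by
  obtain ⟨z, rfl⟩ := oneCocycleClass_surjective ρ.toTopRep c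
  rw [evalClass_oneCocycleClass]
  exact (mem_unramified_iff_forall_apply_eq_zero ρ htriv z).mp hc σ hσ

omit [ValuativeRel F] [TopologicalSpace F] [IsNonarchimedeanLocalField F] in
/-- A continuous crossed homomorphism of a trivial module is a homomorphism: values at products.
[cite: SerreGaloisCohomology1997, I §2.3] -/
theorem cocycle_apply_mul (ρ : DiscreteGaloisModule F N)
    (htriv : ∀ (σ : absoluteGaloisGroup F) (x : N), ρ σ x = x) (z : contOneCocycles ρ.toTopRep)
    (g h : absoluteGaloisGroup F) : z.1 (g * h) = z.1 g + z.1 h :=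
  contOneCocycles.apply_mul_of_trivial (fun σ x => by rw [ContinuousRep.toTopRep_ρ_apply, htriv]) z g h

omit [ValuativeRel F] [TopologicalSpace F] [IsNonarchimedeanLocalField F] in
/-- … values at inverses. [cite: SerreGaloisCohomology1997, I §2.3] -/
theorem cocycle_apply_inv (ρ : DiscreteGaloisModule F N)
    (htriv : ∀ (σ : absoluteGaloisGroup F) (x : N), ρ σ x = x) (z : contOneCocycles ρ.toTopRep)
    (g : absoluteGaloisGroup F) : z.1 g⁻¹ = -z.1 g := by
  have h := cocycle_apply_mul ρ htriv z g g⁻¹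
  rw [mul_inv_cancel, contOneCocycles.apply_one] at h
  exact (neg_eq_of_add_eq_zero_right h.symm).symm

/-- **Independence of the Frobenius lift on `H¹_ur`**: two elements of `Γ_F` that differ by an
inertia element take the same value on every unramified class (`z(φ') = z(φ) + z(φ⁻¹φ')`).
[cite: Howard2004HeegnerKolyvagin, Prop. 1.1.7 (arXiv p. 5, L137–138)] -/
theorem evalClass_eq_of_mem_unramified (ρ : DiscreteGaloisModule F N)
    (htriv : ∀ (σ : absoluteGaloisGroup F) (x : N), ρ σ x = x) {φ φ' : absoluteGaloisGroup F}
    (h : φ⁻¹ * φ' ∈ absInertia F) {c : galoisCohomology ρ 1} (hc : c ∈ unramifiedSubgroup ρ 1) :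
    evalClass ρ htriv φ' c = evalClass ρ htriv φ c := by
  obtain ⟨z, rfl⟩ := oneCocycleClass_surjective ρ.toTopRep c
  rw [evalClass_oneCocycleClass, evalClass_oneCocycleClass]
  have hz := (mem_unramified_iff_forall_apply_eq_zero ρ htriv z).mp hc _ h
  rw [cocycle_apply_mul ρ htriv, cocycle_apply_inv ρ htriv] at hz
  rwa [neg_add_eq_zero, eq_comm] at hz

/-! ## §2 Evaluation at an inertia element on the singular quotient -/

/-- **`H¹_s(F, N) → N`, `c̄ ↦ z(σ₀)`** for `σ₀ ∈ I_F` and a module with trivial action: evaluation at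
`σ₀` kills the unramified classes (they vanish on inertia), so it descends to the singular quotient
`H¹_s = H¹/H¹_ur`.  With `σ₀ = σ_α` this is `c ⊗ α ↦ c(σ_α)`, the second isomorphism of Prop. 1.1.7
at the generator `α`.
[cite: Howard2004HeegnerKolyvagin, Prop. 1.1.7 (arXiv Prop. 2.1.7, p. 5, L138–141)]
[cite: MazurRubinMemoirs2004, Lemma 1.2.1] -/
def singularEval (ρ : DiscreteGaloisModule F N) (htriv : ∀ (σ : absoluteGaloisGroup F) (x : N), ρ σ x = x)
    (σ₀ : absInertia F) : SingularQuotient ρ →+ N :=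
  QuotientAddGroup.lift (unramifiedSubgroup ρ 1) (evalClass ρ htriv (σ₀ : absoluteGaloisGroup F))
    fun _ hc => evalClass_eq_zero_of_mem_unramified_of_mem_absInertia ρ htriv σ₀.2 hc

/-- `singularEval (loc^s [z]) = z(σ₀)`. [cite: Howard2004HeegnerKolyvagin, Prop. 1.1.7 (arXiv p. 5, L138–141)] -/
@[simp] theorem singularEval_singularMap (ρ : DiscreteGaloisModule F N)
    (htriv : ∀ (σ : absoluteGaloisGroup F) (x : N), ρ σ x = x) (σ₀ : absInertia F)
    (c : galoisCohomology ρ 1) :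
    singularEval ρ htriv σ₀ (singularMap ρ c) = evalClass ρ htriv (σ₀ : absoluteGaloisGroup F) c :=
  rfl

/-- `singularEval (loc^s [z]) = z(σ₀)` on cocycles. [cite: Howard2004HeegnerKolyvagin, Prop. 1.1.7 (arXiv p. 5)] -/
theorem singularEval_singularMap_oneCocycleClass (ρ : DiscreteGaloisModule F N)
    (htriv : ∀ (σ : absoluteGaloisGroup F) (x : N), ρ σ x = x) (σ₀ : absInertia F)
    (z : contOneCocycles ρ.toTopRep) :
    singularEval ρ htriv σ₀ (singularMap ρ (oneCocycleClass ρ.toTopRep z)) =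
      z.1 (σ₀ : absoluteGaloisGroup F) := by
  rw [singularEval_singularMap, evalClass_oneCocycleClass]

/-! ## §3 Tame generators of the inertia group at level `q − 1` -/

/-- `0 < q − 1` (plumbing). [folklore] -/
private theorem residueFieldCard_sub_one_pos : 0 < residueFieldCard F - 1 :=
  Nat.sub_pos_of_lt (one_lt_residueFieldCard F)

/-- `q − 1` is prime to the residue characteristic (`q = p^f`; plumbing). [folklore] -/
private theorem not_ringChar_dvd_residueFieldCard_sub_one : ¬ ringChar 𝓀[F] ∣ residueFieldCard F - 1 := by
  obtain ⟨f, hf, hq⟩ := residueFieldCard_eq_pow_ringChar F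
  have hp : (ringChar 𝓀[F]).Prime := ringChar_residueField_prime (F := F)
  intro h
  have h1 : ringChar 𝓀[F] ∣ residueFieldCard F := by rw [hq]; exact dvd_pow_self _ hf.ne'
  have h2 : ringChar 𝓀[F] ∣ residueFieldCard F - (residueFieldCard F - 1) := Nat.dvd_sub h1 h
  rw [Nat.sub_sub_self (one_lt_residueFieldCard F).le] at h2
  exact hp.one_lt.ne' (Nat.dvd_one.mp h2)

/-- **`σ₀ ∈ I_F` is a tame generator (at level `q − 1`)**: the tame (Kummer) character of level
`q − 1`, `σ ↦ σ(ϖ^{1/(q−1)})/ϖ^{1/(q−1)} mod 𝔓 ∈ μ_{q−1}(𝔽̄) = 𝔽_qˣ`, takes a PRIMITIVE `(q−1)`-th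
root of unity at `σ₀` — i.e. `σ₀` maps to a generator of `k_Fˣ` under the canonical surjection
`I_F ↠ I_F/I_F^{wild} ↠ k_Fˣ` (Serre 1972, §1.3 Prop. 2).  These are the elements «`σ_α`, `α` a
generator of `k_vˣ`» of Howard's Prop. 1.1.7 in the tame-character reading (the Artin-symbol reading
replaces `α` by `α^{±1}`: Serre, *Local Fields*, XIV §3).  The uniformiser `ϖ` is quantified
existentially (on `I_F` the character does not depend on it, Serre 1972 §1.7 Remarque).
[cite: SerreInventiones1972, §1.3 Prop. 2 and §1.7 Prop. 3]
[cite: Howard2004HeegnerKolyvagin, Prop. 1.1.7 (arXiv p. 5, L138–141)] -/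
def IsTameGenerator (σ₀ : absInertia F) : Prop :=
  ∃ (ϖ : 𝒪[F]) (hϖ : Irreducible ϖ),
    IsPrimitiveRoot (kummerCharacterQuot F (residueFieldCard_sub_one_pos (F := F)) hϖ.ne_zero σ₀)
      (residueFieldCard F - 1)

/-- **Tame generators exist.** [cite: SerreInventiones1972, §1.3 Prop. 2 (`θ_d` est un isomorphisme)] -/
theorem exists_isTameGenerator : ∃ σ₀ : absInertia F, IsTameGenerator σ₀ := by
  classical
  haveI : (absMaximalIdeal F).IsMaximal := absMaximalIdeal_isMaximal_holds F
  letI : Field (absIntegers 𝒪[F] F ⧸ absMaximalIdeal F) := Ideal.Quotient.field _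
  obtain ⟨ϖ, hϖ⟩ := IsDiscreteValuationRing.exists_irreducible 𝒪[F]
  obtain ⟨σ₀, hσ₀⟩ := exists_isPrimitiveRoot_kummerCharacter (F := F)
    (RingHom.id (absIntegers 𝒪[F] F ⧸ absMaximalIdeal F)) (residueFieldCard_sub_one_pos (F := F))
    (not_ringChar_dvd_residueFieldCard_sub_one (F := F)) hϖ
  refine ⟨σ₀, ϖ, hϖ, ?_⟩
  rw [← IsPrimitiveRoot.coe_units_iff] at hσ₀
  exact hσ₀

namespace IsTameGenerator

variable {σ₀ : absInertia F}

/-- The Kummer character with `ι = id` is `kummerCharacterQuot` (values). [folklore] -/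
private theorem coe_kummerCharacter_id [(absMaximalIdeal F).IsMaximal] {d : ℕ} (hd : 0 < d)
    {ϖ : 𝒪[F]} (hϖ : ϖ ≠ 0) (σ : absInertia F) :
    letI : Field (absIntegers 𝒪[F] F ⧸ absMaximalIdeal F) := Ideal.Quotient.field _
    (kummerCharacter F hd hϖ (RingHom.id (absIntegers 𝒪[F] F ⧸ absMaximalIdeal F)) σ :
        absIntegers 𝒪[F] F ⧸ absMaximalIdeal F) = kummerCharacterQuot F hd hϖ σ :=
  rfl

/-- **Injectivity of evaluation at a tame generator**: a continuous homomorphism `f : I_F → A` into a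
discrete abelian group, of exponent `q − 1`, vanishing at `σ₀`, vanishes.
[cite: SerreInventiones1972, §1.3 Prop. 2 and §1.7 Prop. 5] -/
theorem apply_eq_zero (h : IsTameGenerator σ₀) {A : Type*} [AddCommGroup A] [TopologicalSpace A]
    [DiscreteTopology A] (f : absInertia F → A) (hf : Continuous f)
    (hmul : ∀ σ τ, f (σ * τ) = f σ + f τ) (hfd : ∀ σ, (residueFieldCard F - 1) • f σ = 0)
    (h0 : f σ₀ = 0) (σ : absInertia F) : f σ = 0 := by
  classical
  haveI : (absMaximalIdeal F).IsMaximal := absMaximalIdeal_isMaximal_holds F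
  letI : Field (absIntegers 𝒪[F] F ⧸ absMaximalIdeal F) := Ideal.Quotient.field _
  obtain ⟨ϖ, hϖ, hprim⟩ := h
  have hprim' : IsPrimitiveRoot (kummerCharacter F (residueFieldCard_sub_one_pos (F := F)) hϖ.ne_zero
      (RingHom.id (absIntegers 𝒪[F] F ⧸ absMaximalIdeal F)) σ₀) (residueFieldCard F - 1) := by
    rw [← IsPrimitiveRoot.coe_units_iff]
    exact hprim
  exact apply_eq_zero_of_apply_eq_zero_of_isPrimitiveRoot F (RingHom.id _)
    (residueFieldCard_sub_one_pos (F := F)) (not_ringChar_dvd_residueFieldCard_sub_one (F := F))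
    hϖ hprim' f hf hmul hfd h0 σ

/-- **Surjectivity of evaluation at a tame generator**: every `a` with `(q − 1)·a = 0` is the value at
`σ₀` of a continuous homomorphism `I_F → A` (namely `ψ_a ∘ θ_{q−1}`).
[cite: SerreInventiones1972, §1.3 Prop. 2 and §1.7 Prop. 5] -/
theorem exists_apply_eq (h : IsTameGenerator σ₀) {A : Type*} [AddCommGroup A] [TopologicalSpace A]
    [DiscreteTopology A] (a : A) (ha : (residueFieldCard F - 1) • a = 0) :
    ∃ f : absInertia F → A, Continuous f ∧ (∀ σ τ, f (σ * τ) = f σ + f τ) ∧ f σ₀ = a := by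
  classical
  haveI : (absMaximalIdeal F).IsMaximal := absMaximalIdeal_isMaximal_holds F
  letI : Field (absIntegers 𝒪[F] F ⧸ absMaximalIdeal F) := Ideal.Quotient.field _
  obtain ⟨ϖ, hϖ, hprim⟩ := h
  have hprim' : IsPrimitiveRoot (kummerCharacter F (residueFieldCard_sub_one_pos (F := F)) hϖ.ne_zero
      (RingHom.id (absIntegers 𝒪[F] F ⧸ absMaximalIdeal F)) σ₀) (residueFieldCard F - 1) := by
    rw [← IsPrimitiveRoot.coe_units_iff]
    exact hprim
  exact exists_continuous_apply_eq_of_isPrimitiveRoot F (RingHom.id _)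
    (residueFieldCard_sub_one_pos (F := F)) hϖ hprim' a ha

end IsTameGenerator

/-! ## §4 `H¹_s(F, N) ≅ N` by evaluation at a tame generator (`(q − 1)·N = 0`) -/

omit [TopologicalSpace N] [DiscreteTopology N] in
/-- The order of a finite abelian group killed by `q − 1` is prime to the residue characteristic
(Cauchy; plumbing). [folklore] -/
private theorem natCard_coprime_ringChar_of_smul_eq_zero [Finite N]
    (hq : ∀ x : N, (residueFieldCard F - 1) • x = 0) : (Nat.card N).Coprime (ringChar 𝓀[F]) := by
  classical
  have hp : (ringChar 𝓀[F]).Prime := ringChar_residueField_prime (F := F)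
  rw [Nat.Coprime, Nat.gcd_comm]
  by_contra hne
  have hdvd : ringChar 𝓀[F] ∣ Nat.card N := by
    have hg : Nat.gcd (ringChar 𝓀[F]) (Nat.card N) ∣ ringChar 𝓀[F] := Nat.gcd_dvd_left _ _
    rcases (Nat.dvd_prime hp).mp hg with h1 | h2
    · exact absurd h1 hne
    · rw [← h2]; exact Nat.gcd_dvd_right _ _
  haveI : Fact (ringChar 𝓀[F]).Prime := ⟨hp⟩
  obtain ⟨x, hx⟩ := exists_prime_addOrderOf_dvd_card' (G := N) (ringChar 𝓀[F]) hdvd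
  have h1 : addOrderOf x ∣ residueFieldCard F - 1 := addOrderOf_dvd_of_nsmul_eq_zero (hq x)
  rw [hx] at h1
  exact not_ringChar_dvd_residueFieldCard_sub_one (F := F) h1

/-- **`H¹_s(F, N) → N`, `c̄ ↦ z(σ₀)` is injective** for a tame generator `σ₀` and `(q − 1)·N = 0`:
a class vanishing at `σ₀` vanishes on `I_F` (tame factorisation), i.e. is unramified.
[cite: Howard2004HeegnerKolyvagin, Prop. 1.1.7 (arXiv p. 5, L138–141)] [cite: MazurRubinMemoirs2004, Lemma 1.2.1] -/
theorem singularEval_injective (ρ : DiscreteGaloisModule F N)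
    (htriv : ∀ (σ : absoluteGaloisGroup F) (x : N), ρ σ x = x) {σ₀ : absInertia F}
    (hσ₀ : IsTameGenerator σ₀) (hq : ∀ x : N, (residueFieldCard F - 1) • x = 0) :
    Function.Injective (singularEval ρ htriv σ₀) := by
  refine (injective_iff_map_eq_zero _).mpr fun c hc => ?_
  obtain ⟨c, rfl⟩ := QuotientAddGroup.mk_surjective c
  obtain ⟨z, rfl⟩ := oneCocycleClass_surjective ρ.toTopRep c
  change singularEval ρ htriv σ₀ (singularMap ρ (oneCocycleClass ρ.toTopRep z)) = 0 at hc
  rw [singularEval_singularMap_oneCocycleClass] at hc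
  have hI : ∀ τ : absInertia F, z.1 τ = 0 :=
    hσ₀.apply_eq_zero (fun τ : absInertia F => z.1 τ) (z.1.continuous.comp continuous_subtype_val)
      (fun σ τ => cocycle_apply_mul ρ htriv z σ τ) (fun σ => hq _) hc
  change singularMap ρ (oneCocycleClass ρ.toTopRep z) = 0
  rw [singularMap_eq_zero_iff]
  exact (mem_unramified_iff_forall_apply_eq_zero ρ htriv z).mpr fun τ hτ => hI ⟨τ, hτ⟩

/-- A continuous homomorphism `I_F → N` as a cocycle of the (trivial) module `N|_{I_F}`. [folklore] -/
def inertiaCocycleOfHom (ρ : DiscreteGaloisModule F N)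
    (htriv : ∀ (σ : absoluteGaloisGroup F) (x : N), ρ σ x = x) (f : absInertia F → N)
    (hf : Continuous f) (hmul : ∀ σ τ, f (σ * τ) = f σ + f τ) :
    contOneCocycles (subgroupRep ρ.toTopRep (absInertia F)) :=
  ⟨⟨f, hf⟩, fun g h => by
    change f (g * h) = f g + ρ (g : absoluteGaloisGroup F) (f h)
    rw [hmul, htriv]⟩

/-- Unfolding `inertiaCocycleOfHom` («`H¹(G, A) = Hom(G, A)`» for trivial `A`).
[cite: SerreGaloisCohomology1997, I §2.3] -/
@[simp] theorem inertiaCocycleOfHom_apply (ρ : DiscreteGaloisModule F N)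
    (htriv : ∀ (σ : absoluteGaloisGroup F) (x : N), ρ σ x = x) (f : absInertia F → N)
    (hf : Continuous f) (hmul : ∀ σ τ, f (σ * τ) = f σ + f τ) (σ : absInertia F) :
    (inertiaCocycleOfHom ρ htriv f hf hmul).1 σ = f σ := rfl

/-- **A tame homomorphism of exponent `q − 1` is Frobenius-invariant**: `f(φ⁻¹σφ) = f(σ)` for an
arithmetic Frobenius `φ` (`f(φσ'φ⁻¹) = q·f(σ')` and `(q − 1)·f = 0`).
[cite: SerreInventiones1972, §1.8 Prop. 6] -/
theorem apply_frob_inv_conj_eq [Finite N] (hq : ∀ x : N, (residueFieldCard F - 1) • x = 0)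
    (f : absInertia F → N) (hf : Continuous f) (hmul : ∀ σ τ, f (σ * τ) = f σ + f τ)
    {φ : absoluteGaloisGroup F} (hφ : IsAbsArithFrob φ) (σ : absInertia F) :
    f ⟨φ⁻¹ * σ * φ, by simpa using (inferInstance : (absInertia F).Normal).conj_mem _ σ.2 φ⁻¹⟩ = f σ := by
  set σ' : absInertia F := ⟨φ⁻¹ * σ * φ, by simpa using (inferInstance : (absInertia F).Normal).conj_mem _ σ.2 φ⁻¹⟩
  have hconj : (⟨φ * σ' * φ⁻¹, (inferInstance : (absInertia F).Normal).conj_mem _ σ'.2 φ⟩ : absInertia F) = σ :=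
    Subtype.ext (by change φ * (φ⁻¹ * σ * φ) * φ⁻¹ = σ; group)
  have h := apply_frob_conj_eq_card_nsmul F (natCard_coprime_ringChar_of_smul_eq_zero (F := F) hq)
    f hmul hf hφ σ'
  rw [hconj] at h
  -- `f σ = q • f σ'` and `(q - 1) • f σ' = 0`
  have hq1 : residueFieldCard F • f σ' = f σ' := by
    conv_rhs => rw [← one_smul ℕ (f σ')]
    rw [← Nat.sub_add_cancel (one_lt_residueFieldCard F).le, add_smul, hq, zero_add]
  rw [h, hq1]

/-- **`H¹_s(F, N) → N`, `c̄ ↦ z(σ₀)` is surjective** for a tame generator `σ₀`, `N` finite and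
`(q − 1)·N = 0`: the tame homomorphism `I_F → N` with `σ₀ ↦ a` (level `q − 1`) is fixed by Frobenius
conjugation, hence is the restriction of a class of `H¹(F, N)` (`H¹(F, N) ↠ H¹(I_F, N)^{Fr}`).
[cite: Howard2004HeegnerKolyvagin, Prop. 1.1.7 (arXiv p. 5, L138–141)] [cite: MazurRubinMemoirs2004, Lemma 1.2.1]
[cite: Rubin2000, Lemma 1.3.2] -/
theorem singularEval_surjective [Finite N] (ρ : DiscreteGaloisModule F N)
    (htriv : ∀ (σ : absoluteGaloisGroup F) (x : N), ρ σ x = x) {σ₀ : absInertia F}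
    (hσ₀ : IsTameGenerator σ₀) (hq : ∀ x : N, (residueFieldCard F - 1) • x = 0) :
    Function.Surjective (singularEval ρ htriv σ₀) := by
  intro a
  obtain ⟨f, hf, hmul, hfa⟩ := hσ₀.exists_apply_eq a (hq a)
  obtain ⟨φ, hφ⟩ := exists_isAbsArithFrob_holds (F := F)
  have hφ1 : IsFrobPow φ 1 := IsAbsArithFrob.isFrobPow_holds hφ
  haveI : (absInertia F).Normal := absInertia_normal_holds F
  set y := inertiaCocycleOfHom ρ htriv f hf hmul with hy
  -- Frobenius invariance of the class of `y`
  have hinv : conjMap ρ.toTopRep (absInertia F) φ 1 (oneCocycleClass _ y) = oneCocycleClass _ y := by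
    rw [conjMap_oneCocycleClass]
    congr 1
    apply Subtype.ext
    ext σ
    rw [contOneCocycles.pullback_apply]
    change ρ φ (f (subgroupConj (absInertia F) φ σ)) = f σ
    rw [htriv]
    have hsc : subgroupConj (absInertia F) φ σ =
        ⟨φ⁻¹ * σ * φ, by simpa using (inferInstance : (absInertia F).Normal).conj_mem _ σ.2 φ⁻¹⟩ :=
      Subtype.ext rfl
    rw [hsc]
    exact apply_frob_inv_conj_eq hq f hf hmul hφ σ
  obtain ⟨xc, hxc⟩ := exists_resSubgroup_absInertia_eq_of_conjMap_eq F ρ hφ1 (oneCocycleClass _ y) hinv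
  obtain ⟨z, rfl⟩ := oneCocycleClass_surjective ρ.toTopRep xc
  refine ⟨singularMap ρ (oneCocycleClass ρ.toTopRep z), ?_⟩
  rw [singularEval_singularMap_oneCocycleClass, ← hfa]
  -- the restriction of `z` to `I_F` is `y` (classes of a trivial module are cocycles)
  rw [resSubgroup_oneCocycleClass] at hxc
  have hyz := oneCocycleClass_injective_of_trivial (X := subgroupRep ρ.toTopRep (absInertia F))
    (fun g x => by change ρ (g : absoluteGaloisGroup F) x = x; exact htriv _ _) hxc
  exact congrArg (fun w : contOneCocycles (subgroupRep ρ.toTopRep (absInertia F)) => w.1 σ₀) hyz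

/-- **`H¹_s(F, N) ≅ N`, `c̄ ↦ z(σ₀)`** (bijective) — Prop. 1.1.7's «`H¹_s(K_v,T) ⊗ k_vˣ ≅ T`» read at
the generator of `k_vˣ` picked out by the tame generator `σ₀`.
[cite: Howard2004HeegnerKolyvagin, Prop. 1.1.7 (arXiv p. 5, L129–141)] [cite: MazurRubinMemoirs2004, Lemma 1.2.1] -/
theorem singularEval_bijective [Finite N] (ρ : DiscreteGaloisModule F N)
    (htriv : ∀ (σ : absoluteGaloisGroup F) (x : N), ρ σ x = x) {σ₀ : absInertia F}
    (hσ₀ : IsTameGenerator σ₀) (hq : ∀ x : N, (residueFieldCard F - 1) • x = 0) :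
    Function.Bijective (singularEval ρ htriv σ₀) :=
  ⟨singularEval_injective ρ htriv hσ₀ hq, singularEval_surjective ρ htriv hσ₀ hq⟩

/-! ## §5 `H¹_ur(F, N) ≅ N` by evaluation at a Frobenius lift -/

/-- **Evaluation at a Frobenius lift is injective on `H¹_ur(F, N)`**: an unramified class with
`z(φ) = 0` is zero (`I_F·⟨φ⟩` is dense in `Γ_F`).
[cite: Howard2004HeegnerKolyvagin, Prop. 1.1.7 (arXiv p. 5, L129–138)] [cite: SerreLocalFields1979, XIII §1 Prop. 1] -/
theorem evalClass_eq_zero_of_mem_unramified (ρ : DiscreteGaloisModule F N)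
    (htriv : ∀ (σ : absoluteGaloisGroup F) (x : N), ρ σ x = x) {φ : absoluteGaloisGroup F}
    (hφ : IsFrobPow φ 1) {c : galoisCohomology ρ 1} (hc : c ∈ unramifiedSubgroup ρ 1)
    (h0 : evalClass ρ htriv φ c = 0) : c = 0 := by
  obtain ⟨z, rfl⟩ := oneCocycleClass_surjective ρ.toTopRep c
  rw [evalClass_oneCocycleClass] at h0
  have hz : ∀ n : absInertia F, z.1 n = 0 := fun n =>
    (mem_unramified_iff_forall_apply_eq_zero ρ htriv z).mp hc n n.2
  exact (oneCocycleClass_eq_zero_iff_of_vanishing_absInertia F ρ.toTopRep ρ.continuous_smul hφ z hz).mpr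
    ⟨0, fun _ => map_zero _, by rw [h0, map_zero, sub_zero]⟩

/-- **Evaluation at a Frobenius lift maps `H¹_ur(F, N)` onto `N`** (`N` finite, trivial action): every
`t ∈ N = N^{I_F}` is `z(φ)` for a continuous cocycle `z` vanishing on `I_F`
(`Γ_F/I_F ≅ Ẑ` topologically generated by `φ`).
[cite: Howard2004HeegnerKolyvagin, Prop. 1.1.7 (arXiv p. 5, L129–138)] [cite: SerreLocalFields1979, XIII §1 Prop. 1] -/
theorem exists_mem_unramified_evalClass_eq [Finite N] (ρ : DiscreteGaloisModule F N)
    (htriv : ∀ (σ : absoluteGaloisGroup F) (x : N), ρ σ x = x) {φ : absoluteGaloisGroup F}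
    (hφ : IsFrobPow φ 1) (t : N) :
    ∃ c ∈ unramifiedSubgroup ρ 1, evalClass ρ htriv φ c = t := by
  haveI := absoluteGaloisGroup_compactSpace F
  haveI : (absInertia F).Normal := absInertia_normal_holds F
  have hN : IsClosed (absInertia F : Set (absoluteGaloisGroup F)) := isClosed_absInertia_holds F
  have hfree := isFreeProcyclic_quotient_absInertia' F
  have hdense := dense_zpowers_mk_absInertia_of_isFrobPow F hφ
  obtain ⟨z, hzI, hzφ⟩ := exists_vanishing_apply_eq_of_isFreeProcyclic ρ.toTopRep (absInertia F) hN hfree φ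
    hdense (t := t) (fun n => by rw [ContinuousRep.toTopRep_ρ_apply, htriv])
    (exists_contOneCocycles_apply_eq_of_finite ρ _ (Subgroup.isClosed_topologicalClosure _)
      (dense_zpowers_mk_topologicalClosure' φ)
      (exists_isOpen_index_topologicalClosure_zpowers (absInertia F) hN hfree φ hdense) t)
  refine ⟨oneCocycleClass ρ.toTopRep z, ?_, by rw [evalClass_oneCocycleClass, hzφ]⟩
  exact (mem_unramified_iff_forall_apply_eq_zero ρ htriv z).mpr fun τ hτ => hzI ⟨τ, hτ⟩

/-- **`H¹_ur(F, N) ≅ N` by evaluation at a Frobenius lift** (bijective on the unramified subgroup) —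
Prop. 1.1.7's «`H¹_f(K_v,T) ≅ T/(Frob_v − 1)T`» with `(Frob_v − 1)T = 0`.
[cite: Howard2004HeegnerKolyvagin, Prop. 1.1.7 (arXiv p. 5, L129–138)] -/
theorem evalClass_bijective_unramified [Finite N] (ρ : DiscreteGaloisModule F N)
    (htriv : ∀ (σ : absoluteGaloisGroup F) (x : N), ρ σ x = x) {φ : absoluteGaloisGroup F}
    (hφ : IsFrobPow φ 1) :
    Function.Bijective fun c : unramifiedSubgroup ρ 1 => evalClass ρ htriv φ (c : galoisCohomology ρ 1) := by
  refine ⟨fun c c' h => Subtype.ext ?_, fun t => ?_⟩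
  · have h0 : evalClass ρ htriv φ ((c : galoisCohomology ρ 1) - c') = 0 := by
      rw [map_sub, sub_eq_zero]; exact h
    exact sub_eq_zero.mp (evalClass_eq_zero_of_mem_unramified ρ htriv hφ (sub_mem c.2 c'.2) h0)
  · obtain ⟨c, hc, hct⟩ := exists_mem_unramified_evalClass_eq ρ htriv hφ t
    exact ⟨⟨c, hc⟩, hct⟩

end Local

end Literature.NumberTheory.GaloisCohomology.Howard2004

end
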